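import Mathlib
import Summits.AtomisticToContinuum.Crystallization.Theorems.SquareWellLayerCakeStackingFaultSparsityExactLatticeLedgerSame

/-!
# Exact-lattice ledger, V: the bulk identity and the rim part of the remainder (helper file)

Crux `StackingFaultSparsity` (item stmt-AtomisticToContinuum-14296, routes `SquareWellLayerCake` /
`LaminarSixThreeThree`), line `Sketch`, stub `stub_exactLatticeLedger` (survey obligation M3c+e, the
exact-lattice ledger of the cylinder block flip; landing file
`SquareWellLayerCakeStackingFaultSparsityExactLatticeLedger.lean`, whose module docstring has the
overall map).

`ledger_up_site_identity` (for a lower site in the lateral disc of layer `m ∈ [q₁ - K, q₂]` the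
UP-sum is `ΔF_K(m)` — bulk identity `blockFlip_sum_layer_tsum_sub` — plus an explicit
window-versus-full-layer remainder) and `ledger_up_site_rim` (carrier; the rim part of that
remainder is `≤ 22000 max(depth - 2, 1/2)⁻³`).
-/

noncomputable section
namespace Summit.AtomisticToContinuum.Crystallization.Theorems.SquareWellLayerCake.StackingFaultSparsity
open Literature.MathematicalPhysics.StatisticalMechanics

/-! ## 5b. The bulk identity at a disc site and the rim part of its remainder -/

/-- **The bulk identity at a lower site of the disc** (`blockFlip_sum_layer_tsum_sub` of
`Literature/…/BarlowBlockFlipLayers.lean` with `σ_n = shiftSign s q₁ n` on `(q₁, q₂)`, `0`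
elsewhere): for `q` in the lateral disc of layer `m ∈ [q₁ - K, q₂]`, the UP-sum equals
`ΔF_K(m) = haggLocalEnergyTrunc K J s' m - haggLocalEnergyTrunc K J s m` plus, layer by layer, the
remainder (window sum minus full-layer sum, new minus old) — a purely algebraic regrouping; the
estimate of the remainder is `ledger_up_site_error`. [folklore] -/
theorem ledger_up_site_identity : ∀ K : ℕ, 2 ≤ K →
    ∀ (a h : ℝ) (s : ℤ → ℤ) (q₁ q₂ i₀ j₀ : ℤ) (ρ R : ℝ) (I : Finset (ℤ × ℤ × ℤ))
      (D : ℤ × ℤ × ℤ → (EuclideanSpace ℝ (Fin 3))) (Δ : ℤ × ℤ × ℤ → ℤ × ℤ × ℤ → ℝ),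
      InBox a h → IsHaggSeq s → q₁ < q₂ → (3 : ℤ) ∣ haggLabel s q₂ - haggLabel s q₁ → 1 ≤ ρ →
      ρ + ((q₂ : ℝ) - q₁) * h + K * h + 1 ≤ R →
      (∀ q, InCyl a h s q₁ q₂ i₀ j₀ ρ q.1 q.2.1 q.2.2 →
        D q = ((shiftSign s q₁ q.1 : ℤ) : ℝ) • barlowOffset a) →
      (∀ q, ¬ InCyl a h s q₁ q₂ i₀ j₀ ρ q.1 q.2.1 q.2.2 → D q = 0) →
      (∀ q q', Δ q q' =
        lennardJones (dist (barlowPos a h s q.1 q.2.1 q.2.2 + D q)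
            (barlowPos a h s q'.1 q'.2.1 q'.2.2 + D q')) -
          lennardJones (dist (barlowPos a h s q.1 q.2.1 q.2.2)
            (barlowPos a h s q'.1 q'.2.1 q'.2.2))) →
      (∀ q, q ∈ I ↔ dist (barlowPos a h s q.1 q.2.1 q.2.2) (barlowPos a h s q₁ i₀ j₀) ≤ R) →
      ∀ m ∈ Finset.Icc (q₁ - K) q₂, ∀ q ∈ I, q.1 = m → (latSq (barlowPos a h s q.1 q.2.1 q.2.2) (barlowPos a h s q₁ i₀ j₀) ≤ ρ ^ 2) →
        ∑ q' ∈ I.filter (fun q' => (1 ≤ q'.1 - q.1 ∧ q'.1 - q.1 ≤ K)), Δ q q' =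
          (haggLocalEnergyTrunc K (barlowCoupling lennardJones a h)
                  (fun n : ℤ => if q₁ ≤ n ∧ n < q₂ then -s n else s n) m -
                haggLocalEnergyTrunc K (barlowCoupling lennardJones a h) s m) +
          ∑ k ∈ Finset.Icc 1 K,
            ((∑ q' ∈ I.filter (fun q' => q'.1 = m + k),
            lennardJones (dist (barlowPos a h s q.1 q.2.1 q.2.2 + D q)
              (barlowPos a h s q'.1 q'.2.1 q'.2.2 + D q')) -
          ∑' ij : ℤ × ℤ, lennardJones (dist (barlowPos a h s q.1 q.2.1 q.2.2 + D q)
              (barlowPos a h s (m + k) ij.1 ij.2 +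
                (((fun n : ℤ => if q₁ < n ∧ n < q₂ then shiftSign s q₁ n else 0) (m + k) : ℤ) : ℝ) •
                  barlowOffset a))) -
         (∑ q' ∈ I.filter (fun q' => q'.1 = m + k),
            lennardJones (dist (barlowPos a h s q.1 q.2.1 q.2.2) (barlowPos a h s q'.1 q'.2.1 q'.2.2)) -
          ∑' ij : ℤ × ℤ, lennardJones (dist (barlowPos a h s q.1 q.2.1 q.2.2)
              (barlowPos a h s (m + k) ij.1 ij.2)))) := by
  intro K hK a h s q₁ q₂ i₀ j₀ ρ R I D Δ hbox hs hq hcharge hρ hR hD₁ hD₀ hΔ hI m _ q _ hqm hdisc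
  classical
  subst hqm
  -- the displacement of the site is `σ_{q.1} • w` with the extended sign
  have hDq : D q = (((fun n : ℤ => if q₁ < n ∧ n < q₂ then shiftSign s q₁ n else 0) q.1 : ℤ) : ℝ) •
      barlowOffset a := by
    by_cases hmid : q₁ < q.1 ∧ q.1 < q₂
    · rw [hD₁ q ⟨hmid.1, hmid.2, hdisc⟩]
      simp only [hmid, and_self, if_true]
    · rw [hD₀ q (fun hc => hmid ⟨hc.1, hc.2.1⟩)]
      simp only [hmid, if_false, Int.cast_zero, zero_smul]
  -- the bulk identity of the Literature file
  have hs' : ∀ n, (fun n : ℤ => if q₁ ≤ n ∧ n < q₂ then -s n else s n) n =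
      if q₁ ≤ n ∧ n < q₂ then -s n else s n := fun n => rfl
  have hσ₁ : ∀ n, q₁ < n → n < q₂ →
      (fun n : ℤ => if q₁ < n ∧ n < q₂ then shiftSign s q₁ n else 0) n ≡
        haggLabel s n - haggLabel s q₁ [ZMOD 3] := by
    intro n h1 h2
    simp only [h1, h2, and_self, if_true, shiftSign]
    have h3 := Int.mod_modEq (haggLabel s n - haggLabel s q₁ + 1) 3
    have h4 := h3.sub_right 1
    simpa using h4
  have hσ₀ : ∀ n, n ≤ q₁ ∨ q₂ ≤ n →
      (fun n : ℤ => if q₁ < n ∧ n < q₂ then shiftSign s q₁ n else 0) n = 0 := by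
    intro n hn
    have : ¬ (q₁ < n ∧ n < q₂) := by omega
    simp only [this, if_false]
  have key := blockFlip_sum_layer_tsum_sub lennardJones a h hs hq.le hs' hcharge hσ₁ hσ₀ K q.1 q.2.1 q.2.2
  -- regroup the UP-sum by the layer gap `k`
  have hmaps : ∀ q' ∈ I.filter (fun q' => (1 ≤ q'.1 - q.1 ∧ q'.1 - q.1 ≤ K)), (q'.1 - q.1).toNat ∈ Finset.Icc 1 K := by
    intro q' hq'
    rw [Finset.mem_filter] at hq'
    rw [Finset.mem_Icc]
    constructor <;> omega
  have hfib : ∀ k ∈ Finset.Icc 1 K,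
      (I.filter (fun q' => (1 ≤ q'.1 - q.1 ∧ q'.1 - q.1 ≤ K))).filter (fun q' => (q'.1 - q.1).toNat = k) =
        I.filter (fun q' => q'.1 = q.1 + k) := by
    intro k hk
    rw [Finset.mem_Icc] at hk
    ext q'
    simp only [Finset.mem_filter]
    constructor
    · rintro ⟨⟨h1, h2⟩, h3⟩; exact ⟨h1, by omega⟩
    · rintro ⟨h1, h2⟩; exact ⟨⟨h1, by omega⟩, by omega⟩
  rw [← Finset.sum_fiberwise_of_maps_to hmaps, ← key, ← Finset.sum_add_distrib]
  refine Finset.sum_congr rfl fun k hk => ?_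
  rw [hfib k hk, hDq]
  simp only [hΔ, Finset.sum_sub_distrib, hDq]
  ring

/-- **The rim part of the remainder at a disc site** (part (i) of `ledger_up_site_error`): summed
over the layers `q.1 + k`, `1 ≤ k ≤ K`, and over the window points of those layers, the discrepancy
between the actual displacement `D` and the full-layer shift `σ_{q.1+k} • w` is supported on the
window points OUTSIDE the lateral disc, which are laterally `> depth` away from the site; two shell
sums (`sum_abs_lennardJones_family_le`) give `≤ 22000 · max(depth - 2, 1/2)⁻³`. [folklore] -/
theorem ledger_up_site_rim : ∀ K : ℕ, 2 ≤ K →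
    ∀ (a h : ℝ) (s : ℤ → ℤ) (q₁ q₂ i₀ j₀ : ℤ) (ρ R : ℝ) (I : Finset (ℤ × ℤ × ℤ))
      (D : ℤ × ℤ × ℤ → (EuclideanSpace ℝ (Fin 3))) (Δ : ℤ × ℤ × ℤ → ℤ × ℤ × ℤ → ℝ),
      InBox a h → IsHaggSeq s → q₁ < q₂ → (3 : ℤ) ∣ haggLabel s q₂ - haggLabel s q₁ → 1 ≤ ρ →
      ρ + ((q₂ : ℝ) - q₁) * h + K * h + 1 ≤ R →
      (∀ q, InCyl a h s q₁ q₂ i₀ j₀ ρ q.1 q.2.1 q.2.2 →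
        D q = ((shiftSign s q₁ q.1 : ℤ) : ℝ) • barlowOffset a) →
      (∀ q, ¬ InCyl a h s q₁ q₂ i₀ j₀ ρ q.1 q.2.1 q.2.2 → D q = 0) →
      (∀ q q', Δ q q' =
        lennardJones (dist (barlowPos a h s q.1 q.2.1 q.2.2 + D q)
            (barlowPos a h s q'.1 q'.2.1 q'.2.2 + D q')) -
          lennardJones (dist (barlowPos a h s q.1 q.2.1 q.2.2)
            (barlowPos a h s q'.1 q'.2.1 q'.2.2))) →
      (∀ q, q ∈ I ↔ dist (barlowPos a h s q.1 q.2.1 q.2.2) (barlowPos a h s q₁ i₀ j₀) ≤ R) →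
      ∀ q ∈ I, q.1 ∈ Finset.Icc (q₁ - K) q₂ → (latSq (barlowPos a h s q.1 q.2.1 q.2.2) (barlowPos a h s q₁ i₀ j₀) ≤ ρ ^ 2) →
        ∑ k ∈ Finset.Icc 1 K, ∑ ij ∈ ((I.filter (fun q' => q'.1 = q.1 + k)).image (fun q' => q'.2)),
          |lennardJones (dist (barlowPos a h s q.1 q.2.1 q.2.2 + D q)
              (barlowPos a h s (q.1 + k) ij.1 ij.2 + D (q.1 + k, ij))) -
            lennardJones (dist (barlowPos a h s q.1 q.2.1 q.2.2 + D q)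
              (barlowPos a h s (q.1 + k) ij.1 ij.2 + (((fun n : ℤ => if q₁ < n ∧ n < q₂ then shiftSign s q₁ n else 0) (q.1 + k) : ℤ) : ℝ) • barlowOffset a))| ≤
          22000 * (max (ρ - √(latSq (barlowPos a h s q.1 q.2.1 q.2.2) (barlowPos a h s q₁ i₀ j₀)) - 2) (1 / 2))⁻¹ ^ 3 := by
  intro K hK a h s q₁ q₂ i₀ j₀ ρ R I D Δ hbox hs hq hcharge hρ hR hD₁ hD₀ hΔ hI q hqI hm hdisc
  classical
  obtain ⟨ha, hh⟩ := InBox.pos hbox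
  obtain ⟨ha1, ha1', hh7, -⟩ := InBox.bounds hbox
  have hρ0 : 0 ≤ ρ := by linarith
  have hdepth := one_add_depth_le K hK a h s q₁ q₂ i₀ j₀ ρ R I D Δ hbox hs hq hcharge hρ hR hD₁ hD₀ hΔ hI
    q hm hdisc
  -- the extended registry sign and the displacement of the site
  have hτv : ∀ n : ℤ, (fun n : ℤ => if q₁ < n ∧ n < q₂ then shiftSign s q₁ n else 0) n = 0 ∨ (fun n : ℤ => if q₁ < n ∧ n < q₂ then shiftSign s q₁ n else 0) n = 1 ∨ (fun n : ℤ => if q₁ < n ∧ n < q₂ then shiftSign s q₁ n else 0) n = -1 := by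
    intro n
    simp only
    split_ifs
    · exact shiftSign_cases s q₁ n
    · exact Or.inl rfl
  have hDq : D q = (((fun n : ℤ => if q₁ < n ∧ n < q₂ then shiftSign s q₁ n else 0) q.1 : ℤ) : ℝ) • barlowOffset a := by
    by_cases hmid : q₁ < q.1 ∧ q.1 < q₂
    · rw [hD₁ q ⟨hmid.1, hmid.2, hdisc⟩]
      simp only [hmid, and_self, if_true]
    · rw [hD₀ q (fun hc => hmid ⟨hc.1, hc.2.1⟩)]
      simp only [hmid, if_false, Int.cast_zero, zero_smul]
  -- depth and the target
  set t : ℝ := ρ - √(latSq (barlowPos a h s q.1 q.2.1 q.2.2) (barlowPos a h s q₁ i₀ j₀)) with ht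
  set M : ℝ := max (t - 2) (1 / 2) with hM
  have hM2 : 1 / 2 ≤ M := le_max_right _ _
  have hM0 : 0 < M := by linarith
  have hMt : t - 2 ≤ M := le_max_left _ _
  have ht0 : 0 ≤ t := by
    have h1 : √(latSq (barlowPos a h s q.1 q.2.1 q.2.2) (barlowPos a h s q₁ i₀ j₀)) ≤ ρ := by
      rw [← Real.sqrt_sq hρ0]; exact Real.sqrt_le_sqrt hdisc
    rw [ht]; linarith
  have hM1t : M ≤ 1 + t := max_le (by linarith) (by linarith)
  -- lateral facts about the site
  have hlat_site : √(latSq (barlowPos a h s q.1 q.2.1 q.2.2 + D q) (barlowPos a h s q.1 q.2.1 q.2.2)) ≤ 3 / 5 :=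
    sqrt_latSq_disp_le hbox hD₁ hD₀ q _
  have hnormD : ‖D q‖ ≤ 3 / 5 := by rw [hDq]; exact norm_zsmul_barlowOffset_le hbox (hτv q.1)
  -- partners outside the disc are laterally `> t` away
  have hlat_out : ∀ q' : ℤ × ℤ × ℤ, ¬ (latSq (barlowPos a h s q'.1 q'.2.1 q'.2.2) (barlowPos a h s q₁ i₀ j₀) ≤ ρ ^ 2) →
      t < √(latSq (barlowPos a h s q.1 q.2.1 q.2.2) (barlowPos a h s q'.1 q'.2.1 q'.2.2)) := by
    intro q' hd'
    have h1 : ρ < √(latSq (barlowPos a h s q'.1 q'.2.1 q'.2.2) (barlowPos a h s q₁ i₀ j₀)) := by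
      rw [← Real.sqrt_sq hρ0]
      exact Real.sqrt_lt_sqrt (sq_nonneg ρ) (not_le.1 hd')
    have h2 := sqrt_latSq_triangle (barlowPos a h s q'.1 q'.2.1 q'.2.2) (barlowPos a h s q.1 q.2.1 q.2.2)
      (barlowPos a h s q₁ i₀ j₀)
    rw [latSq_comm (barlowPos a h s q'.1 q'.2.1 q'.2.2) (barlowPos a h s q.1 q.2.1 q.2.2)] at h2
    linarith
  -- vertical gap of an UP-partner
  have hvert : ∀ (k : ℕ), 1 ≤ k → ∀ (ij : ℤ × ℤ) (σ σ' : ℤ),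
      7 / 10 ≤ dist (barlowPos a h s q.1 q.2.1 q.2.2 + (σ : ℝ) • barlowOffset a)
        (barlowPos a h s (q.1 + k) ij.1 ij.2 + (σ' : ℝ) • barlowOffset a) := by
    intro k hk ij σ σ'
    have h1 := abs_sub_mul_le_dist_barlowPos_add_zsmul a h s q.1 q.2.1 q.2.2 σ (q.1 + k) ij.1 ij.2 σ'
    have hk1 : (1 : ℝ) ≤ k := by exact_mod_cast hk
    have h2 : 7 / 10 ≤ |((q.1 : ℝ) - ((q.1 + k : ℤ) : ℝ)) * h| := by
      push_cast
      rw [show ((q.1 : ℝ) - (q.1 + k)) * h = -(k * h) by ring, abs_neg, abs_of_pos (by positivity)]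
      nlinarith
    exact h2.trans h1
  -- reindexing of the finite window sums by in-layer indices
  have hF : ∀ (k : ℕ) (g : ℤ × ℤ × ℤ → ℝ), ∑ q' ∈ I.filter (fun q' => q'.1 = q.1 + k), g q' =
      ∑ ij ∈ (I.filter (fun q' => q'.1 = q.1 + k)).image (fun q' => q'.2), g (q.1 + k, ij) := by
    intro k g
    rw [Finset.sum_image]
    · refine Finset.sum_congr rfl fun q' hq' => ?_
      rw [Finset.mem_filter] at hq'
      rw [← hq'.2, Prod.mk.eta]
    · intro q' hq' q'' hq'' hqq
      rw [Finset.coe_filter, Set.mem_setOf_eq] at hq' hq''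
      exact Prod.ext (hq'.2.trans hq''.2.symm) hqq
  have hFmem : ∀ (k : ℕ) (ij : ℤ × ℤ), ij ∈ (I.filter (fun q' => q'.1 = q.1 + k)).image (fun q' => q'.2) ↔
      ((q.1 + k, ij) : ℤ × ℤ × ℤ) ∈ I := by
    intro k ij
    rw [Finset.mem_image]
    constructor
    · rintro ⟨q', hq', rfl⟩
      rw [Finset.mem_filter] at hq'
      obtain ⟨h1, h2⟩ := hq'
      have : q' = (q.1 + k, q'.2) := Prod.ext h2 rfl
      rw [this] at h1
      exact h1
    · intro h1
      exact ⟨(q.1 + k, ij), Finset.mem_filter.2 ⟨h1, rfl⟩, rfl⟩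
  -- the displacement of a window point of layer `q.1 + k` versus the full-layer shift
  have hDlayer : ∀ (k : ℕ) (ij : ℤ × ℤ), (latSq (barlowPos a h s (q.1 + k) ij.1 ij.2) (barlowPos a h s q₁ i₀ j₀) ≤ ρ ^ 2) →
      D (q.1 + k, ij) = (((fun n : ℤ => if q₁ < n ∧ n < q₂ then shiftSign s q₁ n else 0) (q.1 + k) : ℤ) : ℝ) • barlowOffset a := by
    intro k ij hd
    by_cases hmid : q₁ < q.1 + k ∧ q.1 + k < q₂
    · rw [hD₁ (q.1 + k, ij) ⟨hmid.1, hmid.2, hd⟩]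
      simp only [hmid, and_self, if_true]
    · rw [hD₀ (q.1 + k, ij) (fun hc => hmid ⟨hc.1, hc.2.1⟩)]
      simp only [hmid, if_false, Int.cast_zero, zero_smul]
  have hD0layer : ∀ (k : ℕ) (ij : ℤ × ℤ), ¬ (latSq (barlowPos a h s (q.1 + k) ij.1 ij.2) (barlowPos a h s q₁ i₀ j₀) ≤ ρ ^ 2) →
      D (q.1 + k, ij) = 0 := fun k ij hd => hD₀ _ (fun hc => hd hc.2.2)
  -- pointwise rim bound
  have hrim_pt : ∀ (k : ℕ) (ij : ℤ × ℤ),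
      |lennardJones (dist (barlowPos a h s q.1 q.2.1 q.2.2 + D q)
          (barlowPos a h s (q.1 + k) ij.1 ij.2 + D (q.1 + k, ij))) -
        lennardJones (dist (barlowPos a h s q.1 q.2.1 q.2.2 + D q)
          (barlowPos a h s (q.1 + k) ij.1 ij.2 + (((fun n : ℤ => if q₁ < n ∧ n < q₂ then shiftSign s q₁ n else 0) (q.1 + k) : ℤ) : ℝ) • barlowOffset a))| ≤
      if (latSq (barlowPos a h s (q.1 + k) ij.1 ij.2) (barlowPos a h s q₁ i₀ j₀) ≤ ρ ^ 2) then 0 else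
        (|lennardJones (dist (barlowPos a h s q.1 q.2.1 q.2.2 + D q) (barlowPos a h s (q.1 + k) ij.1 ij.2))| +
         |lennardJones (dist (barlowPos a h s q.1 q.2.1 q.2.2 + D q)
          (barlowPos a h s (q.1 + k) ij.1 ij.2 + (((fun n : ℤ => if q₁ < n ∧ n < q₂ then shiftSign s q₁ n else 0) (q.1 + k) : ℤ) : ℝ) • barlowOffset a))|) := by
    intro k ij
    by_cases hd : (latSq (barlowPos a h s (q.1 + k) ij.1 ij.2) (barlowPos a h s q₁ i₀ j₀) ≤ ρ ^ 2)
    · rw [if_pos hd, hDlayer k ij hd, sub_self, abs_zero]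
    · rw [if_neg hd, hD0layer k ij hd, add_zero]
      exact abs_sub _ _
  -- the rim set and its two shell sums
  have hrimO : ∑ q' ∈ I.filter (fun q' => (1 ≤ q'.1 - q.1 ∧ q'.1 - q.1 ≤ K) ∧ ¬ (latSq (barlowPos a h s q'.1 q'.2.1 q'.2.2) (barlowPos a h s q₁ i₀ j₀) ≤ ρ ^ 2)),
      |lennardJones (dist (barlowPos a h s q.1 q.2.1 q.2.2 + D q) (barlowPos a h s q'.1 q'.2.1 q'.2.2))| ≤
      11000 * M⁻¹ ^ 3 := by
    refine sum_abs_lennardJones_family_le _ _ _ hM2 ?_ ?_ ?_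
    · intro q' _ q'' _ hqq
      exact barlowPos_injective ha hh s hqq
    · intro q' _ q'' _ hne
      exact half_le_dist_old hbox s hne
    · intro q' hq'
      rw [Finset.mem_filter] at hq'
      obtain ⟨-, ⟨hu1, hu2⟩, hd'⟩ := hq'
      refine max_le ?_ ?_
      · have h1 := hlat_out q' hd'
        have h2 := sqrt_latSq_le_dist (barlowPos a h s q.1 q.2.1 q.2.2 + D q) (barlowPos a h s q'.1 q'.2.1 q'.2.2)
        have h3 := sqrt_latSq_triangle (barlowPos a h s q.1 q.2.1 q.2.2) (barlowPos a h s q.1 q.2.1 q.2.2 + D q)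
          (barlowPos a h s q'.1 q'.2.1 q'.2.2)
        rw [latSq_comm (barlowPos a h s q.1 q.2.1 q.2.2) (barlowPos a h s q.1 q.2.1 q.2.2 + D q)] at h3
        linarith
      · obtain ⟨k, hk⟩ : ∃ k : ℕ, q'.1 = q.1 + k := ⟨(q'.1 - q.1).toNat, by omega⟩
        have hk1 : 1 ≤ k := by omega
        have : q' = (q.1 + k, q'.2.1, q'.2.2) := by rw [← hk]
        rw [this, hDq]
        have := hvert k hk1 q'.2 ((fun n : ℤ => if q₁ < n ∧ n < q₂ then shiftSign s q₁ n else 0) q.1) 0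
        simp only [Int.cast_zero, zero_smul, add_zero] at this
        linarith
  have hrimN : ∑ q' ∈ I.filter (fun q' => (1 ≤ q'.1 - q.1 ∧ q'.1 - q.1 ≤ K) ∧ ¬ (latSq (barlowPos a h s q'.1 q'.2.1 q'.2.2) (barlowPos a h s q₁ i₀ j₀) ≤ ρ ^ 2)),
      |lennardJones (dist (barlowPos a h s q.1 q.2.1 q.2.2 + D q)
        (barlowPos a h s q'.1 q'.2.1 q'.2.2 + (((fun n : ℤ => if q₁ < n ∧ n < q₂ then shiftSign s q₁ n else 0) q'.1 : ℤ) : ℝ) • barlowOffset a))| ≤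
      11000 * M⁻¹ ^ 3 := by
    refine sum_abs_lennardJones_family_le _
      (fun q' : ℤ × ℤ × ℤ => barlowPos a h s q'.1 q'.2.1 q'.2.2 + (((fun n : ℤ => if q₁ < n ∧ n < q₂ then shiftSign s q₁ n else 0) q'.1 : ℤ) : ℝ) • barlowOffset a)
      _ hM2 ?_ ?_ ?_
    · intro q' _ q'' _ hqq
      exact shiftFamily_injective ha hh s (fun n : ℤ => if q₁ < n ∧ n < q₂ then shiftSign s q₁ n else 0) hqq
    · intro q' _ q'' _ hne
      refine (InBox.half_le_min hbox).trans (le_dist_barlowPos_add_zsmul a h s ha.le _ _ _ _ _ _ _ _ ?_)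
      exact fun h0 => hne (shiftFamily_injective ha hh s (fun n : ℤ => if q₁ < n ∧ n < q₂ then shiftSign s q₁ n else 0) h0)
    · intro q' hq'
      rw [Finset.mem_filter] at hq'
      obtain ⟨-, ⟨hu1, hu2⟩, hd'⟩ := hq'
      refine max_le ?_ ?_
      · have h1 := hlat_out q' hd'
        have h2 := sqrt_latSq_le_dist (barlowPos a h s q.1 q.2.1 q.2.2 + D q)
          (barlowPos a h s q'.1 q'.2.1 q'.2.2 + (((fun n : ℤ => if q₁ < n ∧ n < q₂ then shiftSign s q₁ n else 0) q'.1 : ℤ) : ℝ) • barlowOffset a)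
        have h3 := sqrt_latSq_triangle (barlowPos a h s q.1 q.2.1 q.2.2) (barlowPos a h s q.1 q.2.1 q.2.2 + D q)
          (barlowPos a h s q'.1 q'.2.1 q'.2.2 + (((fun n : ℤ => if q₁ < n ∧ n < q₂ then shiftSign s q₁ n else 0) q'.1 : ℤ) : ℝ) • barlowOffset a)
        have h4 := sqrt_latSq_triangle (barlowPos a h s q.1 q.2.1 q.2.2)
          (barlowPos a h s q'.1 q'.2.1 q'.2.2 + (((fun n : ℤ => if q₁ < n ∧ n < q₂ then shiftSign s q₁ n else 0) q'.1 : ℤ) : ℝ) • barlowOffset a)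
          (barlowPos a h s q'.1 q'.2.1 q'.2.2)
        have h5 : √(latSq (barlowPos a h s q'.1 q'.2.1 q'.2.2 + (((fun n : ℤ => if q₁ < n ∧ n < q₂ then shiftSign s q₁ n else 0) q'.1 : ℤ) : ℝ) • barlowOffset a)
            (barlowPos a h s q'.1 q'.2.1 q'.2.2)) ≤ 3 / 5 := sqrt_latSq_zsmul_le hbox (hτv q'.1) _
        rw [latSq_comm (barlowPos a h s q.1 q.2.1 q.2.2) (barlowPos a h s q.1 q.2.1 q.2.2 + D q)] at h3
        linarith
      · obtain ⟨k, hk⟩ : ∃ k : ℕ, q'.1 = q.1 + k := ⟨(q'.1 - q.1).toNat, by omega⟩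
        have hk1 : 1 ≤ k := by omega
        have : q' = (q.1 + k, q'.2.1, q'.2.2) := by rw [← hk]
        rw [this, hDq]
        have := hvert k hk1 q'.2 ((fun n : ℤ => if q₁ < n ∧ n < q₂ then shiftSign s q₁ n else 0) q.1) ((fun n : ℤ => if q₁ < n ∧ n < q₂ then shiftSign s q₁ n else 0) (q.1 + k))
        linarith
  -- the rim part, summed over the layers, is the rim set sum
  have hJ1 : ∑ k ∈ Finset.Icc 1 K, ∑ ij ∈ (I.filter (fun q' => q'.1 = q.1 + k)).image (fun q' => q'.2),
      |lennardJones (dist (barlowPos a h s q.1 q.2.1 q.2.2 + D q)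
          (barlowPos a h s (q.1 + k) ij.1 ij.2 + D (q.1 + k, ij))) -
        lennardJones (dist (barlowPos a h s q.1 q.2.1 q.2.2 + D q)
          (barlowPos a h s (q.1 + k) ij.1 ij.2 + (((fun n : ℤ => if q₁ < n ∧ n < q₂ then shiftSign s q₁ n else 0) (q.1 + k) : ℤ) : ℝ) • barlowOffset a))| ≤
      22000 * M⁻¹ ^ 3 := by
    -- pass to the indicator bound and back to window indices
    have step1 : ∀ k ∈ Finset.Icc 1 K,
        ∑ ij ∈ (I.filter (fun q' => q'.1 = q.1 + k)).image (fun q' => q'.2),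
          |lennardJones (dist (barlowPos a h s q.1 q.2.1 q.2.2 + D q)
              (barlowPos a h s (q.1 + k) ij.1 ij.2 + D (q.1 + k, ij))) -
            lennardJones (dist (barlowPos a h s q.1 q.2.1 q.2.2 + D q)
              (barlowPos a h s (q.1 + k) ij.1 ij.2 + (((fun n : ℤ => if q₁ < n ∧ n < q₂ then shiftSign s q₁ n else 0) (q.1 + k) : ℤ) : ℝ) • barlowOffset a))| ≤
        ∑ q' ∈ I.filter (fun q' => q'.1 = q.1 + k),
          (if (latSq (barlowPos a h s q'.1 q'.2.1 q'.2.2) (barlowPos a h s q₁ i₀ j₀) ≤ ρ ^ 2) then 0 else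
            (|lennardJones (dist (barlowPos a h s q.1 q.2.1 q.2.2 + D q) (barlowPos a h s q'.1 q'.2.1 q'.2.2))| +
             |lennardJones (dist (barlowPos a h s q.1 q.2.1 q.2.2 + D q)
              (barlowPos a h s q'.1 q'.2.1 q'.2.2 + (((fun n : ℤ => if q₁ < n ∧ n < q₂ then shiftSign s q₁ n else 0) q'.1 : ℤ) : ℝ) • barlowOffset a))|)) := by
      intro k _
      rw [hF k]
      exact Finset.sum_le_sum fun ij _ => hrim_pt k ij
    refine (Finset.sum_le_sum step1).trans ?_
    -- regroup `∑_k ∑_{layer q.1 + k}` as the sum over the UP-partners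
    have hmaps : ∀ q' ∈ I.filter (fun q' => (1 ≤ q'.1 - q.1 ∧ q'.1 - q.1 ≤ K)), (q'.1 - q.1).toNat ∈ Finset.Icc 1 K := by
      intro q' hq'
      rw [Finset.mem_filter] at hq'
      rw [Finset.mem_Icc]
      constructor <;> omega
    have hfib : ∀ k ∈ Finset.Icc 1 K,
        (I.filter (fun q' => (1 ≤ q'.1 - q.1 ∧ q'.1 - q.1 ≤ K))).filter (fun q' => (q'.1 - q.1).toNat = k) =
          I.filter (fun q' => q'.1 = q.1 + k) := by
      intro k hk
      rw [Finset.mem_Icc] at hk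
      ext q'
      simp only [Finset.mem_filter]
      constructor
      · rintro ⟨⟨h1, h2⟩, h3⟩; exact ⟨h1, by omega⟩
      · rintro ⟨h1, h2⟩; exact ⟨⟨h1, by omega⟩, by omega⟩
    have step2 := Finset.sum_fiberwise_of_maps_to hmaps (fun q' =>
      (if (latSq (barlowPos a h s q'.1 q'.2.1 q'.2.2) (barlowPos a h s q₁ i₀ j₀) ≤ ρ ^ 2) then 0 else
        (|lennardJones (dist (barlowPos a h s q.1 q.2.1 q.2.2 + D q) (barlowPos a h s q'.1 q'.2.1 q'.2.2))| +
         |lennardJones (dist (barlowPos a h s q.1 q.2.1 q.2.2 + D q)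
          (barlowPos a h s q'.1 q'.2.1 q'.2.2 + (((fun n : ℤ => if q₁ < n ∧ n < q₂ then shiftSign s q₁ n else 0) q'.1 : ℤ) : ℝ) • barlowOffset a))|)))
    rw [Finset.sum_congr rfl fun k hk => by rw [hfib k hk]] at step2
    rw [step2, Finset.sum_ite, Finset.sum_const_zero, zero_add]
    have e1 : (I.filter (fun q' => (1 ≤ q'.1 - q.1 ∧ q'.1 - q.1 ≤ K))).filter (fun q' => ¬ (latSq (barlowPos a h s q'.1 q'.2.1 q'.2.2) (barlowPos a h s q₁ i₀ j₀) ≤ ρ ^ 2)) =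
        I.filter (fun q' => (1 ≤ q'.1 - q.1 ∧ q'.1 - q.1 ≤ K) ∧ ¬ (latSq (barlowPos a h s q'.1 q'.2.1 q'.2.2) (barlowPos a h s q₁ i₀ j₀) ≤ ρ ^ 2)) := Finset.filter_filter _ _ _
    rw [e1, Finset.sum_add_distrib]
    linarith [hrimO, hrimN]
  exact hJ1

end Summit.AtomisticToContinuum.Crystallization.Theorems.SquareWellLayerCake.StackingFaultSparsity

end
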